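import Literature.AnabelianGeometry.EtaleTheta.SettingModelChiEllLevels
import Literature.AnabelianGeometry.EtaleTheta.Discharge.Sec1TateTwistOfCyclotomicLevels
import Literature.AnabelianGeometry.EtaleTheta.Discharge.Sec1CyclotomicPackageOfClosure
import Literature.AnabelianGeometry.EtaleTheta.Discharge.Sec1DeltaYEllClosureOfDeltaTheta
import Literature.AnabelianGeometry.EtaleTheta.SettingModelCyclotomicCharacterNontrivial
import Literature.AnabelianGeometry.SemiGraphs.TemperedCurveGalois
import HarnessLib

/-!
# The [EtTh] §1 p. 12 cyclotomic package AT THE χ-TWISTED MODEL: «`(Δ^tp_Y)^ell ≅ Ẑ(1)`» (F-1697), hence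
# «`1 → Ẑ(1) → Δ^ell_X → Ẑ → 1`» (F-0657), «`Δ_Θ ≅ Ẑ(1)`» (F-0658), F-0659, NON-VACUOUSLY WITNESSED at a datum
# whose Galois group acts through THE cyclotomic character of `ℚ̄_p` (file 2b of row «P12-PACKAGE@χ-BRIDGE»; proof-only)

S. Mochizuki, *The étale theta function and its Frobenioid-theoretic manifestations*, Publ. RIMS **45** (2009)
[EtTh], §1, PRIMS PDF p. 12 (printed p. 238): «`1 → Ẑ(1) → Δ^ell_X → Ẑ → 1` … `(Ẑ(1) ≅) Δ_Θ` … Thus,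
`(Δ^tp_Y)^ell ≅ Ẑ(1)`» [cite: MochizukiEtTh2009, §1 p.12]; p. 13 («`K_N := K(ζ_N, q_X^{1/N})`»: `G_K` acts on `μ_N`
through the cyclotomic character) [cite: MochizukiEtTh2009, §1 p.13].

Cell abc-iut, layer L2, seat abc-iut-L2-t7 (gen 4), row «P12-PACKAGE@χ-BRIDGE» (abc-iut-L2-lead R325), file 2b.
PROOF-ONLY (0 definitions).  The typed package (abc-iut-L3 `TemperedCyclotomic`: FACT-LIST F-0657 / F-0658 /
F-0659 / F-1697) is schema-REFUTED as a universal closure (abc-iut-w6-d060, `TemperedCyclotomicClosures`: a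
product datum over `ℚ₃` with trivial Galois action) and, so far, WITNESSED only at Galois-TRIVIAL data over fields
whose absolute Galois group fixes every root of unity (abc-iut-f-172, `Sec1CyclotomicPackageTrivialGalois` /
`…GaloisLocus`).  This file supplies the first witness WITH ARITHMETIC CONTENT: the bridge datum
`D₀ := (ThetaSetting.modelχ′ p).toOncePuncturedTemperedGroup e` (file 2a, `SettingModelChiEllLevels`) for a bundle
`e` whose Galois identification is abc-iut-L3-t12's CANONICAL `galoisIdentification` (such `e` exist:
`exists_oncePuncturedData_galEquiv_eq`, assembled from abc-iut-w5-d111 / w5-d249 / w5-d029's field theorems):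

* §3 **`galApply_bridgeχ'_eq_pow`** — `aug g` raises every `N`-th root of unity of `K̄` to the power `χ_N(g.right)`
  (abc-iut-w5-d091's `apply_eq_pow_levelChar_chi` transported through `galoisIdentification_symm_apply`);
* §4 **`isTateTwist_closureDeltaY_bridgeχ'`** — for the F-1697 carrier `T` (closure of the image of `Δ^tp_Y` in
  `Δ^ell_X`) the `y`-levels restricted to `T` meet abc-iut-L2-t7's criterion `isTateTwist_of_cyclotomicLevels`
  (file 1): surjective (the class of `b`), open kernels, compatible, jointly injective on `T` (the `x`-levels vanish
  there), cyclotomically equivariant (`levelY_conj` + §3) ⇒ **`T` IS a Tate twist `Ẑ(1)`**;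
  `deltaYEllClosureIsoTate_body_bridgeχ'` (with abc-iut-f-172's `exists_closed_stable_closureDeltaY`);
  **`exists_inhabited_origin_cyclotomicPackage_chi`** — with `Ω₀ := «is D₀»`: an INHABITED origin over
  `K₀ = ℚ_p` satisfying `DeltaYEllClosureIsoTate ∧ DeltaEllExtension ∧ DeltaThetaIsoTate ∧ DeltaYEllIsoTate`
  (abc-iut-f-172's `cyclotomicPackage_of_deltaYEllClosureIsoTate`), at which `G_{ℚ_p}` acts through a NON-TRIVIAL
  cyclotomic character (`exists_chi_right_ne_one`, abc-iut-w5-d091's `exists_chi_ne_one`).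

HONEST LABEL: `modelχ′` is a SEMI-SYNTHETIC model (consistency evidence for OUR typed predicates, not the tempered
`π₁` of a once-punctured elliptic curve); the universal closures stay refuted; nothing of [EtTh] is asserted; no side
taken on [IUTchIII] Cor. 3.12; typed ≠ proved.
-/

noncomputable section

namespace Literature.AnabelianGeometry.EtaleTheta.SettingModel

open Literature.AnabelianGeometry.SemiGraphs _root_.Topology
open OncePuncturedTemperedGroup (galApply)

variable (p : ℕ) [Fact p.Prime]

/-! ## §3. The Galois side: `aug g` raises roots of unity to the power `χ_N(g.right)` -/

/-- **The bridge's augmentation acts on `μ_N(K̄)` through THE cyclotomic character** when the bundle's Galois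
identification is abc-iut-L3-t12's canonical `galoisIdentification` (`ι σ = E ∘ σ ∘ E⁻¹` for the chosen
`K`-isomorphism `E : ℚ̄_p ≃ K̄_K`, `galoisIdentification_symm_apply`): for every `N`-th root of unity `ζ ∈ K̄_K`,
`(aug g) ζ = ζ ^ χ_N(g.right)` — abc-iut-w5-d091's `apply_eq_pow_levelChar_chi` transported along `E`.
[cite: MochizukiEtTh2009, §1 p.13] -/
theorem galApply_bridgeχ'_eq_pow (e : (ThetaSetting.modelχ' p).OncePuncturedData)
    (he : e.galEquiv = (curveχ' p).galoisIdentification) (g : PiTpχ p) (N : ℕ+)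
    (ζ : (AlgebraicClosure ↥(curveχ' p).K)ˣ) (hζ : ζ ^ (N : ℕ) = 1) :
    galApply (((ThetaSetting.modelχ' p).toOncePuncturedTemperedGroup e).aug g) (ζ : AlgebraicClosure ↥(curveχ' p).K) =
      ((ζ ^ (ZHatLevel.levelChar N (chi p g.right)).val : (AlgebraicClosure ↥(curveχ' p).K)ˣ) :
        AlgebraicClosure ↥(curveχ' p).K) := by
  rw [bridgeχ'_aug, he]
  set E := Literature.FieldTheory.Galois.algEquivAlgebraicClosure (curveχ' p).K with hE
  set σ : ↥(curveχ' p).GK := (curveχ' p).augGK g with hσ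
  -- the identification on elements: `(ι σ) y = E (σ (E⁻¹ y))`
  have hform : ∀ y : AlgebraicClosure ↥(curveχ' p).K,
      galApply ((curveχ' p).galoisIdentification σ) y = E (((σ : GQp p)) (E.symm y)) := by
    intro y
    have h := (curveχ' p).galoisIdentification_symm_apply ((curveχ' p).galoisIdentification σ) (E.symm y)
    rw [ContinuousMulEquiv.symm_apply_apply, AlgEquiv.apply_symm_apply] at h
    rw [h, AlgEquiv.apply_symm_apply]
    rfl
  rw [hform]
  have hμ : (E.symm (ζ : AlgebraicClosure ↥(curveχ' p).K)) ^ (N : ℕ) = 1 := by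
    rw [← map_pow, ← Units.val_pow_eq_pow_val, hζ, Units.val_one, map_one]
  have hσg : ((σ : GQp p)) = g.right := rfl
  rw [hσg, apply_eq_pow_levelChar_chi p g.right N hμ, map_pow, AlgEquiv.apply_symm_apply, Units.val_pow_eq_pow_val]

/-! ## §4. The Tate twist and the package -/

/-- **«`(Δ^tp_Y)^ell ≅ Ẑ(1)`» AT THE χ-BRIDGE** — the F-1697 carrier is a Tate twist.  For the bridge datum of
`modelχ′` with the canonical Galois identification and ANY `Π^tp_X`-stable `T ≤ Δ^ell_X` whose carrier is the
closure of the image of `Δ^tp_Y` (closedness is not even needed): `IsTateTwist T` — by abc-iut-L2-t7's criterion `isTateTwist_of_cyclotomicLevels`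
fed with the `y`-levels restricted to `T` (surjective: the class of `b` lies in `T` with `y = 1`; open kernels:
continuity; compatible; jointly injective on `T`: the `x`-levels vanish on `T`; cyclotomically equivariant:
`levelY_conj` + `galApply_bridgeχ'_eq_pow`). [cite: MochizukiEtTh2009, §1 p.12] -/
theorem isTateTwist_closureDeltaY_bridgeχ' (e : (ThetaSetting.modelχ' p).OncePuncturedData)
    (he : e.galEquiv = (curveχ' p).galoisIdentification)
    (T : Subgroup ((ThetaSetting.modelχ' p).toOncePuncturedTemperedGroup e).DeltaEll) (hT : ∀ g, ∀ t ∈ T, ((ThetaSetting.modelχ' p).toOncePuncturedTemperedGroup e).conjDeltaEll g t ∈ T)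
    (hTset : (T : Set ((ThetaSetting.modelχ' p).toOncePuncturedTemperedGroup e).DeltaEll) = closure ((fun δ : ((ThetaSetting.modelχ' p).toOncePuncturedTemperedGroup e).delta =>
      (QuotientGroup.mk ⟨((ThetaSetting.modelχ' p).toOncePuncturedTemperedGroup e).toHat δ, Subgroup.le_topologicalClosure _ ⟨δ, δ.2, rfl⟩⟩ : ((ThetaSetting.modelχ' p).toOncePuncturedTemperedGroup e).DeltaEll)) ''
        {δ | (δ : ((ThetaSetting.modelχ' p).toOncePuncturedTemperedGroup e).Pi) ∈ ((ThetaSetting.modelχ' p).toOncePuncturedTemperedGroup e).piY})) :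
    ((ThetaSetting.modelχ' p).toOncePuncturedTemperedGroup e).IsTateTwist T ((ThetaSetting.modelχ' p).toOncePuncturedTemperedGroup e).conjDeltaEll hT := by
  classical
  obtain ⟨X, Y, hXc, hYc, hX, hY⟩ := exists_levels_bridgeχ' p e
  -- the `x`-levels vanish on `T`
  have hXT : ∀ (N : ℕ+) (t : ((ThetaSetting.modelχ' p).toOncePuncturedTemperedGroup e).DeltaEll), t ∈ T → X N t = 1 := by
    intro N t ht
    have hclosed : IsClosed ((X N) ⁻¹' {1} : Set ((ThetaSetting.modelχ' p).toOncePuncturedTemperedGroup e).DeltaEll) := (isClosed_discrete _).preimage (hXc N)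
    have hsub : ((fun δ : ((ThetaSetting.modelχ' p).toOncePuncturedTemperedGroup e).delta =>
        (QuotientGroup.mk ⟨((ThetaSetting.modelχ' p).toOncePuncturedTemperedGroup e).toHat δ, Subgroup.le_topologicalClosure _ ⟨δ, δ.2, rfl⟩⟩ : ((ThetaSetting.modelχ' p).toOncePuncturedTemperedGroup e).DeltaEll)) ''
          {δ | (δ : ((ThetaSetting.modelχ' p).toOncePuncturedTemperedGroup e).Pi) ∈ ((ThetaSetting.modelχ' p).toOncePuncturedTemperedGroup e).piY}) ⊆ (X N) ⁻¹' {1} := by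
      rintro _ ⟨δ, hδ, rfl⟩
      exact levelX_eq_one_of_mem_piY p e X hX N δ hδ
    have hTle : (T : Set ((ThetaSetting.modelχ' p).toOncePuncturedTemperedGroup e).DeltaEll) ⊆ (X N) ⁻¹' {1} := by
      rw [hTset]
      exact closure_minimal hsub hclosed
    exact hTle ht
  -- the class of `b` lies in `T` with `y`-level `1`
  have hb : (SemidirectProduct.inl (bPowGfp (iotaZ (Multiplicative.ofAdd 1))) : PiTpχ p) ∈ ((ThetaSetting.modelχ' p).toOncePuncturedTemperedGroup e).delta :=
    (mem_bridgeχ'_delta_iff p e _).mpr (SemidirectProduct.right_inl _)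
  have hbY : ((⟨(SemidirectProduct.inl (bPowGfp (iotaZ (Multiplicative.ofAdd 1))) : PiTpχ p), hb⟩ :
      ((ThetaSetting.modelχ' p).toOncePuncturedTemperedGroup e).delta) : ((ThetaSetting.modelχ' p).toOncePuncturedTemperedGroup e).Pi) ∈ ((ThetaSetting.modelχ' p).toOncePuncturedTemperedGroup e).piY :=
    (mem_bridgeχ'_piY_iff p e _).mpr (by rw [SemidirectProduct.left_inl, gfpSnd_bPowGfp])
  set β : ((ThetaSetting.modelχ' p).toOncePuncturedTemperedGroup e).DeltaEll := (fun δ : ((ThetaSetting.modelχ' p).toOncePuncturedTemperedGroup e).delta =>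
      (QuotientGroup.mk ⟨((ThetaSetting.modelχ' p).toOncePuncturedTemperedGroup e).toHat δ, Subgroup.le_topologicalClosure _ ⟨δ, δ.2, rfl⟩⟩ : ((ThetaSetting.modelχ' p).toOncePuncturedTemperedGroup e).DeltaEll))
        ⟨(SemidirectProduct.inl (bPowGfp (iotaZ (Multiplicative.ofAdd 1))) : PiTpχ p), hb⟩ with hβ
  have hβT : β ∈ T := by
    rw [← SetLike.mem_coe, hTset]
    exact subset_closure ⟨_, hbY, rfl⟩
  have hβY : ∀ N : ℕ+, Y N β = Multiplicative.ofAdd 1 := fun N => levelY_b p e Y hY N hb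
  -- the level maps on `T`
  let lam : ∀ N : ℕ+, ↥T →* Multiplicative (ZMod N) := fun N => (Y N).comp T.subtype
  have hlam : ∀ (N : ℕ+) (t : ↥T), lam N t = Y N (t : ((ThetaSetting.modelχ' p).toOncePuncturedTemperedGroup e).DeltaEll) := fun _ _ => rfl
  refine ((ThetaSetting.modelχ' p).toOncePuncturedTemperedGroup e).isTateTwist_of_cyclotomicLevels T ((ThetaSetting.modelχ' p).toOncePuncturedTemperedGroup e).conjDeltaEll hT lam ?_ ?_ ?_ ?_ ?_
  · -- surjective: `y = (ofAdd 1)^(y.val) = λ_N (β ^ y.val)`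
    intro N y
    refine ⟨⟨β, hβT⟩ ^ (Multiplicative.toAdd y).val, ?_⟩
    rw [map_pow, hlam]
    change Y N β ^ _ = y
    rw [hβY, ← ofAdd_nsmul, nsmul_eq_mul, mul_one, ZMod.natCast_zmod_val, ofAdd_toAdd]
  · -- open kernels
    intro N
    have hset : ((lam N).ker : Set ↥T) = ((↑) : ↥T → ((ThetaSetting.modelχ' p).toOncePuncturedTemperedGroup e).DeltaEll) ⁻¹' ((Y N) ⁻¹' {1}) := by
      ext t
      rw [SetLike.mem_coe, MonoidHom.mem_ker, hlam, Set.mem_preimage, Set.mem_preimage, Set.mem_singleton_iff]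
    rw [hset]
    exact ((isOpen_discrete _).preimage (hYc N)).preimage continuous_subtype_val
  · -- compatibility
    intro N M t
    rw [hlam, hlam]
    exact levelY_compat p e Y hY N M t
  · -- jointly injective
    intro t ht
    apply Subtype.ext
    exact eq_one_of_levels_eq_one p e X hX Y hY (t : ((ThetaSetting.modelχ' p).toOncePuncturedTemperedGroup e).DeltaEll) fun N => ⟨hXT N t t.2, (hlam N t) ▸ ht N⟩
  · -- cyclotomic equivariance
    intro N g k hk t
    rw [hlam, hlam]
    change Y N (((ThetaSetting.modelχ' p).toOncePuncturedTemperedGroup e).conjDeltaEll g (t : ((ThetaSetting.modelχ' p).toOncePuncturedTemperedGroup e).DeltaEll)) = Y N (t : ((ThetaSetting.modelχ' p).toOncePuncturedTemperedGroup e).DeltaEll) ^ k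
    rw [levelY_conj p e Y hY N g]
    refine OncePuncturedTemperedGroup.pow_eq_pow_of_forall_rootsOfUnity (K := ↥(curveχ' p).K) N
      (fun ζ hζ => ?_) (Y N (t : ((ThetaSetting.modelχ' p).toOncePuncturedTemperedGroup e).DeltaEll)) ?_
    · exact Units.ext ((galApply_bridgeχ'_eq_pow p e he g N ζ hζ).symm.trans (hk ζ hζ))
    · rw [← ofAdd_toAdd (Y N (t : ((ThetaSetting.modelχ' p).toOncePuncturedTemperedGroup e).DeltaEll)), ← ofAdd_nsmul, nsmul_eq_mul, ZMod.natCast_self, zero_mul,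
        ofAdd_zero]

/-- **The body of F-1697 «`(Δ^tp_Y)^ell ≅ Ẑ(1)`» HOLDS at the χ-bridge**: a closed `Π^tp_X`-stable Tate twist
`T ≤ Δ^ell_X` with carrier the closure of the image of `Δ^tp_Y` (abc-iut-f-172's `exists_closed_stable_closureDeltaY`
supplies the subgroup; `isTateTwist_closureDeltaY_bridgeχ'` the twist). [cite: MochizukiEtTh2009, §1 p.12] -/
theorem deltaYEllClosureIsoTate_body_bridgeχ' (e : (ThetaSetting.modelχ' p).OncePuncturedData)
    (he : e.galEquiv = (curveχ' p).galoisIdentification) :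
    ∃ (T : Subgroup ((ThetaSetting.modelχ' p).toOncePuncturedTemperedGroup e).DeltaEll) (hT : ∀ g, ∀ t ∈ T, ((ThetaSetting.modelχ' p).toOncePuncturedTemperedGroup e).conjDeltaEll g t ∈ T),
      IsClosed (T : Set ((ThetaSetting.modelχ' p).toOncePuncturedTemperedGroup e).DeltaEll) ∧ ((ThetaSetting.modelχ' p).toOncePuncturedTemperedGroup e).IsTateTwist T ((ThetaSetting.modelχ' p).toOncePuncturedTemperedGroup e).conjDeltaEll hT ∧
      (T : Set ((ThetaSetting.modelχ' p).toOncePuncturedTemperedGroup e).DeltaEll) = closure ((fun δ : ((ThetaSetting.modelχ' p).toOncePuncturedTemperedGroup e).delta =>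
        (QuotientGroup.mk ⟨((ThetaSetting.modelχ' p).toOncePuncturedTemperedGroup e).toHat δ, Subgroup.le_topologicalClosure _ ⟨δ, δ.2, rfl⟩⟩ : ((ThetaSetting.modelχ' p).toOncePuncturedTemperedGroup e).DeltaEll)) ''
          {δ | (δ : ((ThetaSetting.modelχ' p).toOncePuncturedTemperedGroup e).Pi) ∈ ((ThetaSetting.modelχ' p).toOncePuncturedTemperedGroup e).piY}) := by
  obtain ⟨T, hT, hTc, hTset⟩ := OncePuncturedCyclotomic.exists_closed_stable_closureDeltaY ((ThetaSetting.modelχ' p).toOncePuncturedTemperedGroup e)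
  exact ⟨T, hT, hTc, isTateTwist_closureDeltaY_bridgeχ' p e he T hT hTset, hTset⟩

/-- **A parameter bundle at `modelχ′` whose Galois identification IS the canonical one** (assembled from the landed
field theorems of abc-iut-w5-d111 / w5-d249 / w5-d029: temperedness, slimness, countability, (P1)–(P5)) — so the
hypothesis `he` of this file is met. [cite: MochizukiEtTh2009, §1 p.13] -/
theorem exists_oncePuncturedData_galEquiv_eq :
    ∃ e : (ThetaSetting.modelχ' p).OncePuncturedData, e.galEquiv = (curveχ' p).galoisIdentification := by
  have hker : ((curveχ' p).augK (curveχ' p).galoisIdentification).toMonoidHom.ker = (curveχ' p).DeltaTemp :=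
    (curveχ' p).ker_augK _
  exact ⟨{ galEquiv := (curveχ' p).galoisIdentification
           isTempered := isTempered_piTemp_curveχ p
           isTempered_ker := by rw [hker, curveχ'_deltaTemp]; exact isTempered_deltaTemp_curveχ p
           isSlimGroup := isSlimGroup_PiTpχ_holds p
           isSlimGroup_ker := by rw [hker, curveχ'_deltaTemp]; exact isSlimGroup_deltaTempχ_holds p
           secondCountableTopology := secondCountableTopology_PiTpχ p
           ker_augHat := ker_augHat_modelχ' p
           exists_cusp := exists_isCusp_modelχ' p
           decomp_le_ker_toZ := fun x _ => decomp_modelχ'_le_ker_toZ p x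
           map_aug_decomp := fun x _ => map_aug_decomp_modelχ' p x
           origin := ThetaSetting.modelχ'_isEtThOrigin p }, rfl⟩

/-- **THE CYCLOTOMIC PACKAGE OF [EtTh] §1 p. 12 HAS A WITNESS WITH ARITHMETIC CONTENT.**  Over `K₀ = ℚ_p` (the
bottom subfield of `ℚ̄_p`) there is an INHABITED origin hypothesis `Ω` — «is the bridge datum of the χ-twisted
cusped model with the canonical Galois identification» — for which all four typed predicates hold:
`DeltaYEllClosureIsoTate Ω` (F-1697, this file) and hence `DeltaEllExtension Ω` (F-0657), `DeltaThetaIsoTate Ω`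
(F-0658), `DeltaYEllIsoTate Ω` (F-0659) by abc-iut-f-172's `cyclotomicPackage_of_deltaYEllClosureIsoTate`.  Unlike the
Galois-trivial witnesses of `Sec1CyclotomicPackageTrivialGalois`, here `Gal(K̄₀/K₀) = G_{ℚ_p}` acts on the roots of
unity through a NON-TRIVIAL cyclotomic character.  (Consistency evidence for the typed package at a semi-synthetic
model; the universal closures stay refuted.) [cite: MochizukiEtTh2009, §1 p.12] -/
theorem exists_inhabited_origin_cyclotomicPackage_chi :
    ∃ Ω : TemperedPiOrigin ↥(curveχ' p).K,
      (∃ D, Ω.IsTateOrigin D) ∧ OncePuncturedTemperedGroup.DeltaYEllClosureIsoTate Ω ∧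
        OncePuncturedTemperedGroup.DeltaEllExtension Ω ∧ OncePuncturedTemperedGroup.DeltaThetaIsoTate Ω ∧
        OncePuncturedTemperedGroup.DeltaYEllIsoTate Ω := by
  obtain ⟨e, he⟩ := exists_oncePuncturedData_galEquiv_eq p
  refine ⟨{ IsOfGeometricOrigin := fun _ => True
            IsTateOrigin := fun D => D = ((ThetaSetting.modelχ' p).toOncePuncturedTemperedGroup e)
            isOfGeometricOrigin_of_isTateOrigin := fun _ _ => trivial }, ⟨_, rfl⟩, ?_⟩
  have h1697 : OncePuncturedTemperedGroup.DeltaYEllClosureIsoTate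
      ({ IsOfGeometricOrigin := fun _ => True
         IsTateOrigin := fun D => D = ((ThetaSetting.modelχ' p).toOncePuncturedTemperedGroup e)
         isOfGeometricOrigin_of_isTateOrigin := fun _ _ => trivial } : TemperedPiOrigin ↥(curveχ' p).K) := by
    intro D hD
    change D = ((ThetaSetting.modelχ' p).toOncePuncturedTemperedGroup e) at hD
    subst hD
    exact deltaYEllClosureIsoTate_body_bridgeχ' p e he
  exact ⟨h1697, OncePuncturedCyclotomic.cyclotomicPackage_of_deltaYEllClosureIsoTate _ h1697⟩

/-- … and at this witness the Galois group MOVES roots of unity: the cyclotomic character of `G_{ℚ_p}` is not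
trivial (abc-iut-w5-d091's `exists_chi_ne_one`) — contrast abc-iut-f-172's locus theorem, by which no Galois-TRIVIAL
datum over such a field can carry the package. [cite: MochizukiEtTh2009, §1 p.13] -/
theorem exists_chi_right_ne_one : ∃ g : PiTpχ p, chi p g.right ≠ 1 := by
  obtain ⟨σ, hσ⟩ := exists_chi_ne_one p
  exact ⟨SemidirectProduct.inr σ, by rwa [SemidirectProduct.right_inr]⟩

end Literature.AnabelianGeometry.EtaleTheta.SettingModel

end
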